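/-
Copyright: statement-level skeleton of a published paper (lit-balaban cell, Phase-2 proof seat p26). No proof claims beyond what
the kernel checks below.
-/
import Literature.MathematicalPhysics.QuantumFieldTheory.Balaban1983to89.B3CxiTadpoleLimit
import Literature.MathematicalPhysics.QuantumFieldTheory.Balaban1983to89.B3Eq123Counterterms

/-!
# `Balaban1983to89.B3Eq122LocalDivergence` — T. Bałaban, *(Higgs)₂,₃ quantum fields in a finite volume. III. Renormalization*,
Commun. Math. Phys. **88** (1983) 411–445 [Balaban1983Higgs3], p. 416: *"It is easily seen that the expressions in (1.22) are
divergent as ε → 0 (except the third)"* — PROVED for the three LOCAL terms ①②③ of (1.22), d = 3 and d = 2, with a new LOWER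
bound C^ξ(0) ≥ (1/π²)·log ξ^{−1} for the free tadpole on ξℤ²

statement-level skeleton of published theorems with citation tags; proofs where landed; nothing here is a claim about the
Yang–Mills mass gap

PDF held: `paper:balaban1983-higgs-2-3-quantum-fields-finite-volume` (journal page = PDF page + 410); p. 416 read on the ×2 render
`run/shared/lean/pub/pub-balaban/b2b-balaban-ref1/pages/1983-cmp88-higgs23-III/1983-cmp88-higgs23-III-p006-x2.png`.

CITATION HEADER (lean-in-tree rule).  lit-balaban MEGA-FORMALIZATION (HOME `run/shared/lean/pub/lit-balaban/`), Phase 2, seat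
**p26 gen 39** (unit `lit-balaban-p26-g39`), free-target protocol G.5-34(d) (TAKING #2 HOME/STATUS.md 2026-08-23T07:03:51Z); ROW
**B3.Eq1.19-1.22** of `HOME/lit-balaban-r15/ROWS-B3.md`, the (1.22) cell (fold owner r15; r15's 06:32:18Z list of the p. 416/417
sentences not yet served names this one).  Companion of this seat's `B3Eq123Counterterms` ((1.22)/(1.23) as analytic expressions,
p355997).

THE PRINTED TEXT.  p. 416 [PDF 6], after (1.22), verbatim: *"It is easily seen that the expressions in (1.22) are divergent as
ε → 0 (except the third). It will follow from our future considerations that Σ^ε_1, Σ^ε_2 are convergent and"* [p. 417] *"the terms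
of order higher than 4 (in coupling constants) in the expansion of Σ^ε are convergent also."*  The three LOCAL terms of (1.22) (the
coefficients of δ^ε(x − x′)) are ① −4(N+2)λC^ε_0(0), ② e²dC^ε(0)q², ③ (2·3/4!)de⁴ε²(C^ε(0))²q⁴ (`B3Eq123Counterterms.sig1/2/3`).

WHAT IS PROVED, AND ON WHICH CARRIER.  The free propagator of record is the momentum integral `B3Sect3VectorSelfEnergy.Cxi d ξ`
(*"C^ξ = (−Δ^ξ + 1)^{−1}"*, (3.16) p. 437, unit mass, on ξℤ^d — print itself passes to the infinite lattice before (3.3), p. 433);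
its value at coinciding points `Cxi d ξ 0` is the number C^ξ(0) of the tadpoles.  The MASSIVE propagators of (1.22) at coinciding
points (*"C^ε_0 = (−Δ^ε_0 + m²)^{−1}"*, *"C^ε = (−Δ^ε + μ₀²)^{−1}"*) are `tadpoleMass d ε m` (def with body, the momentum integral on
εℤ^d), and §2b PROVES the scaling C^ε_{(m)}(0) = m^{d−2}C^{mε}(0) (`tadpoleMass_eq`), so that every statement is made both for the
unit-mass family ξ ↦ C^ξ(0) of §3 and, by composition with ε ↦ mε, for the massive tadpoles as ε → 0⁺ (`tendsto_tadpoleMass_atTop_three/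
two`, `tendsto_eps_sq_mul_tadpoleMass_sq_three/two` — in d = 3 the limit of ε²C^ε(0)² is the same constant K² for every mass).
* §1 **d = 3**: `tendsto_Cxi_zero_atTop_three` — C^ξ(0) → +∞ as ξ → 0⁺ (from p20's limit ξC^ξ(0) → K, `B3CxiTadpoleLimit.
  tendsto_xi_mul_Cxi_zero_three`, and the positive lower bound K ≥ 1/12, `tadpoleConst_mem_Icc`); `tendsto_xi_sq_mul_Cxi_sq_three` —
  ξ²C^ξ(0)² → K² (the combination of ③ CONVERGES).
* §2 **d = 2, the lower bound** (the item T1 of r15's `B3CxiTadpole`: *"lower bounds of the same order hold … but are neither printed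
  nor proved here"*): `lapSymbol_one_le_norm_sq` (Δ¹(q) ≤ d‖q‖²_∞ from 2 − 2cos t ≤ t²), the radial MINORANT
  `radial_le_boxIntegral` (∫_{|q_μ|≤π} dq/(Δ¹(q)+ξ²) ≥ d·2^d·∫₀^π y^{d−1}dy/(dy² + ξ²): the sup-norm ball of radius π inside the box,
  Mathlib's `integral_fun_norm_addHaar`), the closed form ∫₀^π y dy/(2y² + ξ²) = ¼(log(2π² + ξ²) − log ξ²) (private
  `radial_integral_two_eq`, fundamental theorem of calculus), and **`log_le_Cxi_zero_two`**: C^ξ(0) ≥ (1/π²)·log ξ^{−1} for every ξ > 0 (with r15's upper bound: `Cxi_zero_two_log_bounds`, the tadpole is exactly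
  logarithmic); hence `tendsto_Cxi_zero_atTop_two` (C^ξ(0) → +∞) and `tendsto_xi_sq_mul_Cxi_sq_two` (ξ²C^ξ(0)² → 0).
* §3 **the sentence for ①②③**: the local coefficients as functions of the propagator value (`loc1`, `loc2`, `loc3`, = the
  δ^ε-coefficients of `B3Eq123Counterterms.sig1/2/3` by `rfl`: `sig1_eq_loc1` …) — for λ ≠ 0, resp. e ≠ 0 and q² ≠ 0, |①|, |②| → ∞
  as ξ → 0⁺ in d = 3 and d = 2 (`tendsto_abs_loc1_atTop`, `tendsto_abs_loc2_atTop`), while ③ = (2·3/4!)de⁴q⁴·(ξC^ξ(0))² CONVERGES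
  (`tendsto_loc3_three`: to (2·3/4!)·3·e⁴q⁴K²; `tendsto_loc3_two`: to 0) — *"except the third"*; the sentence in one statement:
  **`sentence_122_local`** (unit mass) and **`sentence_122_local_massive`** (① with the scalar mass m, ②③ with the vector mass μ₀,
  ε → 0⁺).
NOT ADDRESSED: the non-local terms ④–⑦ of (1.22) (their «divergence as ε → 0» is the ultraviolet behaviour of the summed graphs,
the business of Prop. 1 / the degree census — p18 `B3Sect1Graphs122.pictures122_deg_three` at the level of degrees), the sentences on
Σ^ε_1, Σ^ε_2 and on the orders > 4 (forward references to Prop. 1), finite-volume (torus) corrections (the statements are on εℤ^d;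
p20's `B3GkTadpoleLimitZeroTorus` bounds the d = 3 torus-minus-lattice tadpole difference).  0 sorry, 0 new `Prop` facts.
Unit `lit-balaban-p26` gen 39 (literature-prover-lit-balaban-p26-g39-0), 2026-08-23.
-/

noncomputable section

namespace Literature.MathematicalPhysics.QuantumFieldTheory.Balaban1983to89.B3Eq122LocalDivergence

open B3Sect3VectorSelfEnergy B3CxiPropagator B3CxiTadpole B3CxiTadpoleLimit
open _root_.MeasureTheory _root_.Filter _root_.Set _root_.Metric _root_.Topology

/-! ## §1 d = 3: the tadpole diverges like ξ^{−1}; ξ²C^ξ(0)² converges -/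

section Three

/-- **d = 3: C^ξ(0) → +∞ as ξ → 0⁺** (p20's ξC^ξ(0) → K with K ≥ 1/12, so eventually C^ξ(0) ≥ (1/24)ξ^{−1}).
[cite: Balaban1983Higgs3, (1.22) p.416] -/
theorem tendsto_Cxi_zero_atTop_three : Tendsto (fun ξ : ℝ => Cxi 3 ξ 0) (𝓝[>] 0) atTop := by
  have hK := tadpoleConst_mem_Icc.1
  have hev : ∀ᶠ ξ : ℝ in 𝓝[>] 0, (1 / 24 : ℝ) < ξ * Cxi 3 ξ 0 :=
    tendsto_xi_mul_Cxi_zero_three.eventually (lt_mem_nhds (by linarith))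
  have hlow : Tendsto (fun ξ : ℝ => (1 / 24 : ℝ) * ξ⁻¹) (𝓝[>] 0) atTop :=
    tendsto_inv_nhdsGT_zero.const_mul_atTop (by norm_num)
  refine tendsto_atTop_mono' _ ?_ hlow
  filter_upwards [hev, self_mem_nhdsWithin] with ξ hξ hpos
  have hpos' : (0 : ℝ) < ξ := hpos
  rw [← div_eq_mul_inv, div_le_iff₀ hpos', mul_comm]
  exact hξ.le

/-- **d = 3: ξ²C^ξ(0)² → K²** (K = the tadpole constant (2π)^{−3}∫dq/Δ¹(q)) — the combination ε²(C^ε(0))² of ③ CONVERGES.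
[cite: Balaban1983Higgs3, (1.22) p.416] -/
theorem tendsto_xi_sq_mul_Cxi_sq_three :
    Tendsto (fun ξ : ℝ => ξ ^ 2 * Cxi 3 ξ 0 ^ 2) (𝓝[>] 0)
      (𝓝 (((2 * Real.pi)⁻¹ ^ 3 * ∫ q in bzBox 3 1, (lapSymbol 3 1 q)⁻¹) ^ 2)) := by
  have h := tendsto_xi_mul_Cxi_zero_three.pow 2
  refine h.congr' (Eventually.of_forall fun ξ => ?_)
  simp only [mul_pow]

end Three

/-! ## §2 d = 2: the lower bound C^ξ(0) ≥ (1/π²)·log ξ^{−1} -/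

section Minorant

variable {d : ℕ} {ξ : ℝ}

/-- kernel: 2 − 2cos t ≤ t². [folklore] -/
private theorem two_sub_two_cos_le_sq (t : ℝ) : 2 - 2 * Real.cos t ≤ t ^ 2 := by
  have h := Real.one_sub_sq_div_two_le_cos (x := t)
  linarith

/-- **The symbol is at most d·‖q‖²** (sup norm): Δ¹(q) = Σ_μ(2 − 2cos q_μ) ≤ Σ_μ q_μ² ≤ d‖q‖²_∞.
[cite: Balaban1983Higgs3, (3.28) p.441] -/
theorem lapSymbol_one_le_norm_sq (q : Fin d → ℝ) : lapSymbol d 1 q ≤ (d : ℝ) * ‖q‖ ^ 2 := by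
  rw [lapSymbol_one_apply]
  calc ∑ μ : Fin d, (2 - 2 * Real.cos (q μ)) ≤ ∑ μ : Fin d, ‖q‖ ^ 2 := by
        refine Finset.sum_le_sum fun μ _ => (two_sub_two_cos_le_sq (q μ)).trans ?_
        have h : |q μ| ≤ ‖q‖ := by rw [← Real.norm_eq_abs]; exact norm_le_pi_norm q μ
        rw [← sq_abs]
        exact pow_le_pow_left₀ (abs_nonneg _) h 2
    _ = (d : ℝ) * ‖q‖ ^ 2 := by rw [Finset.sum_const, Finset.card_univ, Fintype.card_fin, nsmul_eq_mul]

/-- kernel: hence the tadpole integrand dominates the radial function 1/(d‖q‖² + ξ²) (ξ > 0). [folklore] -/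
private theorem inv_radial_le_inv_lapSymbol (hξ : 0 < ξ) (q : Fin d → ℝ) :
    1 / ((d : ℝ) * ‖q‖ ^ 2 + ξ ^ 2) ≤ 1 / (lapSymbol d 1 q + ξ ^ 2) := by
  have h0 := lapSymbol_nonneg d 1 q
  exact one_div_le_one_div_of_le (by positivity) (by linarith [lapSymbol_one_le_norm_sq q])

/-- kernel: the radial minorant function is continuous (ξ > 0). [folklore] -/
private theorem continuous_radial (hξ : 0 < ξ) :
    Continuous fun q : Fin d → ℝ => 1 / ((d : ℝ) * ‖q‖ ^ 2 + ξ ^ 2) := by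
  have h : ∀ q : Fin d → ℝ, (d : ℝ) * ‖q‖ ^ 2 + ξ ^ 2 ≠ 0 := fun q => by positivity
  exact continuous_const.div (by fun_prop) h

/-- kernel: the tadpole integrand is continuous (ξ > 0). [folklore] -/
private theorem continuous_invLap (hξ : 0 < ξ) :
    Continuous fun q : Fin d → ℝ => 1 / (lapSymbol d 1 q + ξ ^ 2) := by
  have h : ∀ q : Fin d → ℝ, lapSymbol d 1 q + ξ ^ 2 ≠ 0 := fun q => by
    have := lapSymbol_nonneg d 1 q
    positivity
  exact continuous_const.div ((continuous_lapSymbol d 1).add continuous_const) h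

/-- kernel (polar coordinates for the sup norm, radius π): ∫_{‖q‖<π} dq/(d‖q‖² + ξ²) = d·2^d·∫₀^π y^{d−1}dy/(dy² + ξ²)
— Mathlib's `integral_fun_norm_addHaar`, the sup-norm unit ball of ℝ^d having Lebesgue volume 2^d (r15's `B3CxiTadpole` device
with radius π + 1 ↦ π). [folklore] -/
private theorem integral_ball_radial (hd : 0 < d) (ξ : ℝ) :
    ∫ q in Metric.ball (0 : Fin d → ℝ) Real.pi, 1 / ((d : ℝ) * ‖q‖ ^ 2 + ξ ^ 2) =
      (d : ℝ) * 2 ^ d * ∫ y in Set.Ioo 0 Real.pi, y ^ (d - 1) * (1 / ((d : ℝ) * y ^ 2 + ξ ^ 2)) := by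
  haveI : Nontrivial (Fin d → ℝ) := by
    haveI : Nonempty (Fin d) := ⟨⟨0, hd⟩⟩
    infer_instance
  set g : ℝ → ℝ := fun y => if y < Real.pi then 1 / ((d : ℝ) * y ^ 2 + ξ ^ 2) else 0 with hg
  have h1 : (fun q : Fin d → ℝ => g ‖q‖) =
      (Metric.ball (0 : Fin d → ℝ) Real.pi).indicator fun q => 1 / ((d : ℝ) * ‖q‖ ^ 2 + ξ ^ 2) := by
    funext q
    by_cases hq : ‖q‖ < Real.pi
    · rw [Set.indicator_of_mem (mem_ball_zero_iff.2 hq)]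
      simp [hg, hq]
    · rw [Set.indicator_of_notMem (fun h => hq (mem_ball_zero_iff.1 h))]
      simp [hg, hq]
  have h2 := MeasureTheory.integral_fun_norm_addHaar (volume : Measure (Fin d → ℝ)) g
  rw [h1, integral_indicator measurableSet_ball] at h2
  refine h2.trans ?_
  have hdim : Module.finrank ℝ (Fin d → ℝ) = d := by simp
  have hvol : (volume : Measure (Fin d → ℝ)).real (Metric.ball 0 1) = 2 ^ d := by
    rw [measureReal_def, Real.volume_pi_ball 0 one_pos, ENNReal.toReal_ofReal (by positivity)]
    simp
  have h3 : (fun y : ℝ => y ^ (Module.finrank ℝ (Fin d → ℝ) - 1) • g y) =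
      (Set.Iio Real.pi).indicator fun y => y ^ (d - 1) * (1 / ((d : ℝ) * y ^ 2 + ξ ^ 2)) := by
    funext y
    rw [hdim, smul_eq_mul]
    by_cases hy : y < Real.pi
    · rw [Set.indicator_of_mem (Set.mem_Iio.2 hy)]
      simp [hg, hy]
    · rw [Set.indicator_of_notMem (fun h => hy (Set.mem_Iio.1 h))]
      simp [hg, hy]
  rw [h3, setIntegral_indicator measurableSet_Iio, Set.Ioi_inter_Iio, hdim, hvol]
  simp only [nsmul_eq_mul, smul_eq_mul]
  ring

/-- **The radial MINORANT of the tadpole integral** (d ≥ 1, ξ > 0):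
d·2^d·∫₀^π y^{d−1}dy/(dy² + ξ²) ≤ ∫_{|q_μ|≤π} dq/(Δ¹(q) + ξ²) — Δ¹(q) ≤ d‖q‖², the sup-norm ball of radius π inside the box
(`B3CxiTadpoleLimit.ball_subset_bzBox`), polar coordinates. [cite: BalabanImbrieJaffe1985, (1.3) p.300] -/
theorem radial_le_boxIntegral (hd : 0 < d) (hξ : 0 < ξ) :
    (d : ℝ) * 2 ^ d * ∫ y in Set.Ioo 0 Real.pi, y ^ (d - 1) * (1 / ((d : ℝ) * y ^ 2 + ξ ^ 2)) ≤
      ∫ q in bzBox d 1, 1 / (lapSymbol d 1 q + ξ ^ 2) := by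
  rw [← integral_ball_radial hd ξ]
  have hN := continuous_radial (d := d) hξ
  have hI := continuous_invLap (d := d) hξ
  have hcpt : IsCompact (bzBox d 1) := by rw [bzBox_one_eq_Icc]; exact isCompact_Icc
  calc ∫ q in Metric.ball (0 : Fin d → ℝ) Real.pi, 1 / ((d : ℝ) * ‖q‖ ^ 2 + ξ ^ 2)
      ≤ ∫ q in Metric.ball (0 : Fin d → ℝ) Real.pi, 1 / (lapSymbol d 1 q + ξ ^ 2) :=
        setIntegral_mono_on
          ((hN.continuousOn.integrableOn_compact (isCompact_closedBall 0 Real.pi)).mono_set ball_subset_closedBall)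
          ((hI.continuousOn.integrableOn_compact (isCompact_closedBall 0 Real.pi)).mono_set ball_subset_closedBall)
          measurableSet_ball fun q _ => inv_radial_le_inv_lapSymbol hξ q
    _ ≤ ∫ q in bzBox d 1, 1 / (lapSymbol d 1 q + ξ ^ 2) :=
        setIntegral_mono_set (hI.continuousOn.integrableOn_compact hcpt)
          (ae_of_all _ fun q => by have := lapSymbol_nonneg d 1 q; positivity) ball_subset_bzBox.eventuallyLE

/-- kernel: the one-dimensional integral for d = 2 in closed form, ∫₀^π y dy/(2y² + ξ²) = ¼(log(2π² + ξ²) − log ξ²)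
(fundamental theorem of calculus, primitive ¼log(2y² + ξ²)). [folklore] -/
private theorem radial_integral_two_eq (hξ : 0 < ξ) :
    ∫ y in Set.Ioo 0 Real.pi, y ^ (2 - 1) * (1 / (((2 : ℕ) : ℝ) * y ^ 2 + ξ ^ 2)) =
      1 / 4 * (Real.log (2 * Real.pi ^ 2 + ξ ^ 2) - Real.log (ξ ^ 2)) := by
  have hR : (0 : ℝ) ≤ Real.pi := Real.pi_pos.le
  rw [← integral_Ioc_eq_integral_Ioo, ← intervalIntegral.integral_of_le hR]
  have hden : ∀ y : ℝ, 0 < 2 * y ^ 2 + ξ ^ 2 := fun y => by positivity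
  have hF : ∀ y ∈ Set.uIcc 0 Real.pi,
      HasDerivAt (fun y : ℝ => 1 / 4 * Real.log (2 * y ^ 2 + ξ ^ 2))
        (y ^ (2 - 1) * (1 / (((2 : ℕ) : ℝ) * y ^ 2 + ξ ^ 2))) y := by
    intro y _
    have h1 : HasDerivAt (fun y : ℝ => 2 * y ^ 2 + ξ ^ 2) (2 * (2 * y)) y := by
      have h := ((hasDerivAt_pow 2 y).const_mul (2 : ℝ)).add_const (ξ ^ 2)
      simpa using h
    have h2 := (h1.log (hden y).ne').const_mul (1 / 4 : ℝ)
    have h3 : (1 / 4 : ℝ) * (2 * (2 * y) / (2 * y ^ 2 + ξ ^ 2)) = y ^ (2 - 1) * (1 / (((2 : ℕ) : ℝ) * y ^ 2 + ξ ^ 2)) := by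
      rw [show (2 : ℕ) - 1 = 1 from rfl, pow_one]
      push_cast
      field_simp
      ring
    rw [h3] at h2
    exact h2
  have hcont : Continuous fun y : ℝ => y ^ (2 - 1) * (1 / (((2 : ℕ) : ℝ) * y ^ 2 + ξ ^ 2)) := by
    have h : ∀ y : ℝ, ((2 : ℕ) : ℝ) * y ^ 2 + ξ ^ 2 ≠ 0 := fun y => by positivity
    exact (continuous_pow _).mul (continuous_const.div (by fun_prop) h)
  rw [intervalIntegral.integral_eq_sub_of_hasDerivAt hF (hcont.intervalIntegrable _ _)]
  simp only [ne_eq, OfNat.ofNat_ne_zero, not_false_eq_true, zero_pow, mul_zero, zero_add]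
  ring

/-- **d = 2: THE LOWER BOUND C^ξ(0) ≥ (1/π²)·log ξ^{−1}** for every ξ > 0 (the free tadpole of the unit-mass propagator (3.16) on
ξℤ² diverges at least logarithmically; with r15's upper bound `B3CxiTadpole.Cxi_zero_le_two_log` the divergence is exactly
logarithmic). [cite: BalabanImbrieJaffe1985, (1.3) p.300] -/
theorem log_le_Cxi_zero_two (hξ : 0 < ξ) : 1 / Real.pi ^ 2 * Real.log ξ⁻¹ ≤ Cxi 2 ξ 0 := by
  rw [Cxi_zero_eq hξ]
  have hI := radial_le_boxIntegral (d := 2) (by norm_num) hξ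
  rw [radial_integral_two_eq hξ] at hI
  have hξ2 : 0 < ξ ^ 2 := by positivity
  have hπ : 0 < Real.pi := Real.pi_pos
  -- log(2π² + ξ²) ≥ 0 since 2π² + ξ² ≥ 1 (π > 3)
  have hlog0 : 0 ≤ Real.log (2 * Real.pi ^ 2 + ξ ^ 2) :=
    Real.log_nonneg (by nlinarith [Real.pi_gt_three])
  have hlogξ : Real.log (ξ ^ 2) = -2 * Real.log ξ⁻¹ := by
    rw [Real.log_pow, Real.log_inv]; push_cast; ring
  have hfac : (2 * Real.pi)⁻¹ ^ 2 * (ξ ^ 2 * (ξ ^ 2)⁻¹) = 1 / (4 * Real.pi ^ 2) := by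
    field_simp
    ring
  rw [hfac]
  have hpos : (0 : ℝ) ≤ 1 / (4 * Real.pi ^ 2) := by positivity
  calc 1 / Real.pi ^ 2 * Real.log ξ⁻¹
      = 1 / (4 * Real.pi ^ 2) * (((2 : ℕ) : ℝ) * 2 ^ 2 * (1 / 4 * (0 - Real.log (ξ ^ 2)))) := by
        rw [hlogξ]; push_cast; field_simp; ring
    _ ≤ 1 / (4 * Real.pi ^ 2) *
          (((2 : ℕ) : ℝ) * 2 ^ 2 * (1 / 4 * (Real.log (2 * Real.pi ^ 2 + ξ ^ 2) - Real.log (ξ ^ 2)))) := by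
        gcongr
    _ ≤ 1 / (4 * Real.pi ^ 2) * ∫ q in bzBox 2 1, 1 / (lapSymbol 2 1 q + ξ ^ 2) :=
        mul_le_mul_of_nonneg_left hI hpos

/-- **d = 2, two-sided: the tadpole is EXACTLY logarithmic** — (1/π²)·log ξ^{−1} ≤ C^ξ(0) ≤ ¼log(1 + 4(π+1)²/π²) + ½·log ξ^{−1}
for 0 < ξ ≤ 1 (lower: this file; upper: r15's `B3CxiTadpole.Cxi_zero_le_two_log`), the sharp form of *"O(ln ε^{−1}) (d = 2)"*.
[cite: BalabanImbrieJaffe1985, (1.3) p.300] -/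
theorem Cxi_zero_two_log_bounds (hξ : 0 < ξ) (hξ1 : ξ ≤ 1) :
    1 / Real.pi ^ 2 * Real.log ξ⁻¹ ≤ Cxi 2 ξ 0 ∧
      Cxi 2 ξ 0 ≤ 1 / 4 * Real.log (1 + 4 * (Real.pi + 1) ^ 2 / Real.pi ^ 2) + 1 / 2 * Real.log ξ⁻¹ :=
  ⟨log_le_Cxi_zero_two hξ, Cxi_zero_le_two_log hξ hξ1⟩

/-- **d = 2: C^ξ(0) → +∞ as ξ → 0⁺** (logarithmically). [cite: Balaban1983Higgs3, (1.22) p.416] -/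
theorem tendsto_Cxi_zero_atTop_two : Tendsto (fun ξ : ℝ => Cxi 2 ξ 0) (𝓝[>] 0) atTop := by
  have hlow : Tendsto (fun ξ : ℝ => 1 / Real.pi ^ 2 * Real.log ξ⁻¹) (𝓝[>] 0) atTop :=
    (Real.tendsto_log_atTop.comp tendsto_inv_nhdsGT_zero).const_mul_atTop (by positivity)
  refine tendsto_atTop_mono' _ ?_ hlow
  filter_upwards [self_mem_nhdsWithin] with ξ hξ
  exact log_le_Cxi_zero_two hξ

/-- **d = 2: ξ²C^ξ(0)² → 0** (p20's ξC^ξ(0) → 0) — the combination of ③ CONVERGES. [cite: Balaban1983Higgs3, (1.22) p.416] -/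
theorem tendsto_xi_sq_mul_Cxi_sq_two : Tendsto (fun ξ : ℝ => ξ ^ 2 * Cxi 2 ξ 0 ^ 2) (𝓝[>] 0) (𝓝 0) := by
  have h := tendsto_xi_mul_Cxi_zero_two.pow 2
  rw [zero_pow two_ne_zero] at h
  refine h.congr' (Eventually.of_forall fun ξ => ?_)
  simp only [mul_pow]

end Minorant

/-! ## §2b The massive propagators of (1.22) at coinciding points: scaling to the unit-mass tadpole -/

section Massive

variable {d : ℕ} {ε m : ℝ}

/-- **The massive free propagator of the ε-lattice at coinciding points**: for *"C^ε_0 = (−Δ^ε_0 + m²)^{−1}"* (p. 416), resp.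
*"C^ε = (−Δ^ε + μ₀²)^{−1} for the vector field"*, the number C^ε_0(0) = (2π)^{−d}∫_{|p_μ|≤π/ε} dp/(Δ^ε(p) + m²) (momentum integral on
εℤ^d, the tree's `bzBox`/`lapSymbol`; mass `m`, resp. `μ₀`). [cite: Balaban1983Higgs3, (1.22) p.416] -/
def tadpoleMass (d : ℕ) (ε m : ℝ) : ℝ := (2 * Real.pi)⁻¹ ^ d * ∫ p in bzBox d ε, 1 / (lapSymbol d ε p + m ^ 2)

/-- **Scaling to unit mass**: C^ε_{(m)}(0) = m^{d−2}·C^{mε}(0) (p = q/ε on the box, Δ^ε(q/ε) = ε^{−2}Δ¹(q), then r15's rescaled form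
`B3CxiTadpole.Cxi_zero_eq` of the unit-mass tadpole at spacing mε) — the massive tadpoles of (1.22) are the unit-mass tadpole of (3.16)
read at ξ = mε. [cite: Balaban1983Higgs3, (3.16) p.437] -/
theorem tadpoleMass_eq (hε : 0 < ε) (hm : 0 < m) : tadpoleMass d ε m = m ^ d * (m ^ 2)⁻¹ * Cxi d (m * ε) 0 := by
  have hmε : 0 < m * ε := mul_pos hm hε
  have hε0 : ε ≠ 0 := hε.ne'
  have hm0 : m ≠ 0 := hm.ne'
  -- p = q/ε on the box
  have h1 : (fun p : Fin d → ℝ => 1 / (lapSymbol d ε p + m ^ 2)) =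
      fun p => (fun q : Fin d → ℝ => 1 / (ε⁻¹ ^ 2 * lapSymbol d 1 q + m ^ 2)) (ε • p) := by
    funext p
    rw [lapSymbol_eq_smul ε p]
  -- 1/(ε⁻²Δ¹ + m²) = ε²/(Δ¹ + (mε)²)
  have h2 : (fun q : Fin d → ℝ => 1 / (ε⁻¹ ^ 2 * lapSymbol d 1 q + m ^ 2)) =
      fun q => ε ^ 2 * (1 / (lapSymbol d 1 q + (m * ε) ^ 2)) := by
    funext q
    have hL := lapSymbol_nonneg d 1 q
    have hA : lapSymbol d 1 q + (m * ε) ^ 2 ≠ 0 := by positivity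
    have hB : ε⁻¹ ^ 2 * lapSymbol d 1 q + m ^ 2 ≠ 0 := by positivity
    field_simp
  unfold tadpoleMass
  rw [h1, integral_bzBox_comp_smul hε (fun q : Fin d → ℝ => 1 / (ε⁻¹ ^ 2 * lapSymbol d 1 q + m ^ 2)), h2,
    integral_const_mul, Cxi_zero_eq hmε]
  field_simp
  ring

/-- kernel: ε ↦ mε maps (0, ·) to (0, ·) near 0 (m > 0). [folklore] -/
private theorem tendsto_const_mul_nhdsGT (hm : 0 < m) : Tendsto (fun ε : ℝ => m * ε) (𝓝[>] 0) (𝓝[>] 0) := by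
  refine tendsto_nhdsWithin_iff.2 ⟨?_, ?_⟩
  · have h : Tendsto (fun ε : ℝ => m * ε) (𝓝 0) (𝓝 (m * 0)) := tendsto_const_nhds.mul tendsto_id
    rw [mul_zero] at h
    exact h.mono_left nhdsWithin_le_nhds
  · filter_upwards [self_mem_nhdsWithin] with ε hε
    exact mul_pos hm hε

/-- **d = 3: the massive tadpole diverges**, C^ε_{(m)}(0) = m·C^{mε}(0) → +∞ as ε → 0⁺ (every mass m > 0).
[cite: Balaban1983Higgs3, (1.22) p.416] -/
theorem tendsto_tadpoleMass_atTop_three (hm : 0 < m) : Tendsto (fun ε : ℝ => tadpoleMass 3 ε m) (𝓝[>] 0) atTop := by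
  have h := (tendsto_Cxi_zero_atTop_three.comp (tendsto_const_mul_nhdsGT hm)).const_mul_atTop
    (show (0 : ℝ) < m ^ 3 * (m ^ 2)⁻¹ by positivity)
  refine h.congr' ?_
  filter_upwards [self_mem_nhdsWithin] with ε hε
  exact (tadpoleMass_eq hε hm).symm

/-- **d = 2: the massive tadpole diverges**, C^ε_{(m)}(0) = C^{mε}(0) → +∞ as ε → 0⁺ (every mass m > 0).
[cite: Balaban1983Higgs3, (1.22) p.416] -/
theorem tendsto_tadpoleMass_atTop_two (hm : 0 < m) : Tendsto (fun ε : ℝ => tadpoleMass 2 ε m) (𝓝[>] 0) atTop := by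
  have h := (tendsto_Cxi_zero_atTop_two.comp (tendsto_const_mul_nhdsGT hm)).const_mul_atTop
    (show (0 : ℝ) < m ^ 2 * (m ^ 2)⁻¹ by positivity)
  refine h.congr' ?_
  filter_upwards [self_mem_nhdsWithin] with ε hε
  exact (tadpoleMass_eq hε hm).symm

/-- **d = 3: ε²·C^ε_{(m)}(0)² → K²**, the same constant for every mass m > 0 (ε²m²C^{mε}(0)² = (mε·C^{mε}(0))²).
[cite: Balaban1983Higgs3, (1.22) p.416] -/
theorem tendsto_eps_sq_mul_tadpoleMass_sq_three (hm : 0 < m) :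
    Tendsto (fun ε : ℝ => ε ^ 2 * tadpoleMass 3 ε m ^ 2) (𝓝[>] 0)
      (𝓝 (((2 * Real.pi)⁻¹ ^ 3 * ∫ q in bzBox 3 1, (lapSymbol 3 1 q)⁻¹) ^ 2)) := by
  have h := tendsto_xi_sq_mul_Cxi_sq_three.comp (tendsto_const_mul_nhdsGT hm)
  refine h.congr' ?_
  filter_upwards [self_mem_nhdsWithin] with ε hε
  have hm0 : m ≠ 0 := hm.ne'
  simp only [Function.comp_apply, tadpoleMass_eq hε hm]
  field_simp

/-- **d = 2: ε²·C^ε_{(m)}(0)² → 0** for every mass m > 0. [cite: Balaban1983Higgs3, (1.22) p.416] -/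
theorem tendsto_eps_sq_mul_tadpoleMass_sq_two (hm : 0 < m) :
    Tendsto (fun ε : ℝ => ε ^ 2 * tadpoleMass 2 ε m ^ 2) (𝓝[>] 0) (𝓝 0) := by
  have h := (tendsto_xi_sq_mul_Cxi_sq_two.comp (tendsto_const_mul_nhdsGT hm)).const_mul (m ^ 2)⁻¹
  rw [mul_zero] at h
  refine h.congr' ?_
  filter_upwards [self_mem_nhdsWithin] with ε hε
  have hm0 : m ≠ 0 := hm.ne'
  simp only [Function.comp_apply, tadpoleMass_eq hε hm]
  field_simp

end Massive

/-! ## §3 The sentence of p. 416 for the three local terms ①②③ of (1.22) -/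

section LocalTerms

open B3Eq123Counterterms B3Sect3ScalarSelfEnergy

/-- the coefficient of δ^ε in ①: −4(N+2)λ·C^ε_0(0), as a function of the propagator value c₀ = C^ε_0(0).
[cite: Balaban1983Higgs3, (1.22) p.416] -/
def loc1 (N : ℕ) (lam c0 : ℝ) : ℝ := -4 * ((N : ℝ) + 2) * lam * c0

/-- the coefficient of δ^ε in ②: e²d·C^ε(0)·q², as a function of c = C^ε(0). [cite: Balaban1983Higgs3, (1.22) p.416] -/
def loc2 (d : ℕ) (e q2 c : ℝ) : ℝ := e ^ 2 * (d : ℝ) * c * q2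

/-- the coefficient of δ^ε in ③: (2·3/4!)de⁴ε²(C^ε(0))²q⁴, as a function of ε and c = C^ε(0). [cite: Balaban1983Higgs3, (1.22) p.416] -/
def loc3 (d : ℕ) (e q2 ε c : ℝ) : ℝ := (2 * 3 : ℝ) / (Nat.factorial 4 : ℕ) * (d : ℝ) * e ^ 4 * ε ^ 2 * c ^ 2 * q2 ^ 2

variable {P : Params} {j : ℕ} (D : SEData P j)

/-- ① of `B3Eq123Counterterms` IS `loc1` at the diagonal value of C^ε_0 times δ^ε. [cite: Balaban1983Higgs3, (1.22) p.416] -/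
theorem sig1_eq_loc1 (x x' : Site P j) : sig1 D x x' = loc1 D.N D.lam (D.C0 x x) * delta D.w x x' := rfl

/-- ② IS `loc2` at the diagonal value of C^ε times δ^ε. [cite: Balaban1983Higgs3, (1.22) p.416] -/
theorem sig2_eq_loc2 (x x' : Site P j) : sig2 D x x' = loc2 P.d D.e D.q2 (D.C x x) * delta D.w x x' := rfl

/-- ③ IS `loc3` at ε and the diagonal value of C^ε times δ^ε. [cite: Balaban1983Higgs3, (1.22) p.416] -/
theorem sig3_eq_loc3 (x x' : Site P j) : sig3 D x x' = loc3 P.d D.e D.q2 D.ε (D.C x x) * delta D.w x x' := by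
  simp only [sig3, loc3]

/-- kernel: |a·f| → ∞ along a filter when f → +∞ and a ≠ 0. [folklore] -/
private theorem tendsto_abs_const_mul_atTop {l : Filter ℝ} {f : ℝ → ℝ} {a : ℝ} (ha : a ≠ 0) (hf : Tendsto f l atTop) :
    Tendsto (fun ξ => |a * f ξ|) l atTop := by
  have h := hf.const_mul_atTop (abs_pos.2 ha)
  refine tendsto_atTop_mono' _ ?_ h
  filter_upwards [hf.eventually_ge_atTop 0] with ξ hξ
  rw [abs_mul, abs_of_nonneg hξ]

/-- **① diverges**: for λ ≠ 0, |−4(N+2)λC^ξ(0)| → ∞ as ξ → 0⁺, in d = 3 and in d = 2. [cite: Balaban1983Higgs3, (1.22) p.416] -/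
theorem tendsto_abs_loc1_atTop (N : ℕ) {lam : ℝ} (hlam : lam ≠ 0) :
    Tendsto (fun ξ : ℝ => |loc1 N lam (Cxi 3 ξ 0)|) (𝓝[>] 0) atTop ∧
      Tendsto (fun ξ : ℝ => |loc1 N lam (Cxi 2 ξ 0)|) (𝓝[>] 0) atTop := by
  have ha : -4 * ((N : ℝ) + 2) * lam ≠ 0 := mul_ne_zero (by positivity) hlam
  exact ⟨tendsto_abs_const_mul_atTop ha tendsto_Cxi_zero_atTop_three,
    tendsto_abs_const_mul_atTop ha tendsto_Cxi_zero_atTop_two⟩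

/-- **② diverges**: for e ≠ 0 and q² ≠ 0, |e²dC^ξ(0)q²| → ∞ as ξ → 0⁺, in d = 3 and in d = 2.
[cite: Balaban1983Higgs3, (1.22) p.416] -/
theorem tendsto_abs_loc2_atTop {e q2 : ℝ} (he : e ≠ 0) (hq : q2 ≠ 0) :
    Tendsto (fun ξ : ℝ => |loc2 3 e q2 (Cxi 3 ξ 0)|) (𝓝[>] 0) atTop ∧
      Tendsto (fun ξ : ℝ => |loc2 2 e q2 (Cxi 2 ξ 0)|) (𝓝[>] 0) atTop := by
  have h3 : (fun ξ : ℝ => |loc2 3 e q2 (Cxi 3 ξ 0)|) = fun ξ => |e ^ 2 * (3 : ℕ) * q2 * Cxi 3 ξ 0| := by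
    funext ξ; simp only [loc2]; ring_nf
  have h2 : (fun ξ : ℝ => |loc2 2 e q2 (Cxi 2 ξ 0)|) = fun ξ => |e ^ 2 * (2 : ℕ) * q2 * Cxi 2 ξ 0| := by
    funext ξ; simp only [loc2]; ring_nf
  have ha3 : e ^ 2 * (3 : ℕ) * q2 ≠ 0 := mul_ne_zero (mul_ne_zero (pow_ne_zero 2 he) (by norm_num)) hq
  have ha2 : e ^ 2 * (2 : ℕ) * q2 ≠ 0 := mul_ne_zero (mul_ne_zero (pow_ne_zero 2 he) (by norm_num)) hq
  rw [h3, h2]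
  exact ⟨tendsto_abs_const_mul_atTop ha3 tendsto_Cxi_zero_atTop_three,
    tendsto_abs_const_mul_atTop ha2 tendsto_Cxi_zero_atTop_two⟩

/-- **③ converges, d = 3** (*"except the third"*): (2·3/4!)·3·e⁴ξ²C^ξ(0)²q⁴ → (2·3/4!)·3·e⁴q⁴·K² as ξ → 0⁺, K the tadpole
constant. [cite: Balaban1983Higgs3, (1.22) p.416] -/
theorem tendsto_loc3_three (e q2 : ℝ) :
    Tendsto (fun ξ : ℝ => loc3 3 e q2 ξ (Cxi 3 ξ 0)) (𝓝[>] 0)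
      (𝓝 ((2 * 3 : ℝ) / (Nat.factorial 4 : ℕ) * (3 : ℕ) * e ^ 4 *
        ((2 * Real.pi)⁻¹ ^ 3 * ∫ q in bzBox 3 1, (lapSymbol 3 1 q)⁻¹) ^ 2 * q2 ^ 2)) := by
  have h := (tendsto_xi_sq_mul_Cxi_sq_three.const_mul ((2 * 3 : ℝ) / (Nat.factorial 4 : ℕ) * (3 : ℕ) * e ^ 4)).mul_const
    (q2 ^ 2)
  refine h.congr' (Eventually.of_forall fun ξ => ?_)
  simp only [loc3]
  ring

/-- **③ converges, d = 2**: (2·3/4!)·2·e⁴ξ²C^ξ(0)²q⁴ → 0 as ξ → 0⁺. [cite: Balaban1983Higgs3, (1.22) p.416] -/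
theorem tendsto_loc3_two (e q2 : ℝ) :
    Tendsto (fun ξ : ℝ => loc3 2 e q2 ξ (Cxi 2 ξ 0)) (𝓝[>] 0) (𝓝 0) := by
  have h := (tendsto_xi_sq_mul_Cxi_sq_two.const_mul ((2 * 3 : ℝ) / (Nat.factorial 4 : ℕ) * (2 : ℕ) * e ^ 4)).mul_const
    (q2 ^ 2)
  rw [mul_zero, zero_mul] at h
  refine h.congr' (Eventually.of_forall fun ξ => ?_)
  simp only [loc3]
  ring

/-- **p. 416, verbatim: *"It is easily seen that the expressions in (1.22) are divergent as ε → 0 (except the third)"*** — for the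
three local terms, with the unit-mass free propagator on ξℤ^d, d ∈ {2, 3}: ① and ② diverge (λ ≠ 0, e ≠ 0, q² ≠ 0) and ③ has a
finite limit. [cite: Balaban1983Higgs3, (1.22) p.416] -/
theorem sentence_122_local (N : ℕ) {lam e q2 : ℝ} (hlam : lam ≠ 0) (he : e ≠ 0) (hq : q2 ≠ 0) :
    (Tendsto (fun ξ : ℝ => |loc1 N lam (Cxi 3 ξ 0)|) (𝓝[>] 0) atTop ∧
      Tendsto (fun ξ : ℝ => |loc2 3 e q2 (Cxi 3 ξ 0)|) (𝓝[>] 0) atTop ∧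
      ∃ c : ℝ, Tendsto (fun ξ : ℝ => loc3 3 e q2 ξ (Cxi 3 ξ 0)) (𝓝[>] 0) (𝓝 c)) ∧
    (Tendsto (fun ξ : ℝ => |loc1 N lam (Cxi 2 ξ 0)|) (𝓝[>] 0) atTop ∧
      Tendsto (fun ξ : ℝ => |loc2 2 e q2 (Cxi 2 ξ 0)|) (𝓝[>] 0) atTop ∧
      ∃ c : ℝ, Tendsto (fun ξ : ℝ => loc3 2 e q2 ξ (Cxi 2 ξ 0)) (𝓝[>] 0) (𝓝 c)) :=
  ⟨⟨(tendsto_abs_loc1_atTop N hlam).1, (tendsto_abs_loc2_atTop he hq).1, ⟨_, tendsto_loc3_three e q2⟩⟩,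
    ⟨(tendsto_abs_loc1_atTop N hlam).2, (tendsto_abs_loc2_atTop he hq).2, ⟨0, tendsto_loc3_two e q2⟩⟩⟩

/-! ### The same with print's massive propagators C^ε_0 = (−Δ^ε_0 + m²)^{−1}, C^ε = (−Δ^ε + μ₀²)^{−1} -/

/-- kernel: |loc2| with a massive tadpole, rewritten as |a·C|. [folklore] -/
private theorem abs_loc2_eq (d : ℕ) (e q2 c : ℝ) : |loc2 d e q2 c| = |e ^ 2 * (d : ℝ) * q2 * c| := by
  simp only [loc2]; ring_nf

/-- **p. 416's sentence with the MASSIVE propagators of (1.22) at coinciding points** (`tadpoleMass`: ① with the scalar mass m of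
C^ε_0, ②③ with the vector mass μ₀ of C^ε; ε → 0⁺ on εℤ^d, d ∈ {2, 3}): for λ ≠ 0, e ≠ 0, q² ≠ 0 and m, μ₀ > 0, |①| → ∞, |②| → ∞ and
③ has a finite limit (d = 3: (2·3/4!)·3·e⁴q⁴K², independent of μ₀; d = 2: 0) — *"divergent as ε → 0 (except the third)"*.
[cite: Balaban1983Higgs3, (1.22) p.416] -/
theorem sentence_122_local_massive (N : ℕ) {lam e q2 m μ0 : ℝ} (hlam : lam ≠ 0) (he : e ≠ 0) (hq : q2 ≠ 0)
    (hm : 0 < m) (hμ : 0 < μ0) :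
    (Tendsto (fun ε : ℝ => |loc1 N lam (tadpoleMass 3 ε m)|) (𝓝[>] 0) atTop ∧
      Tendsto (fun ε : ℝ => |loc2 3 e q2 (tadpoleMass 3 ε μ0)|) (𝓝[>] 0) atTop ∧
      Tendsto (fun ε : ℝ => loc3 3 e q2 ε (tadpoleMass 3 ε μ0)) (𝓝[>] 0)
        (𝓝 ((2 * 3 : ℝ) / (Nat.factorial 4 : ℕ) * (3 : ℕ) * e ^ 4 *
          ((2 * Real.pi)⁻¹ ^ 3 * ∫ q in bzBox 3 1, (lapSymbol 3 1 q)⁻¹) ^ 2 * q2 ^ 2))) ∧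
    (Tendsto (fun ε : ℝ => |loc1 N lam (tadpoleMass 2 ε m)|) (𝓝[>] 0) atTop ∧
      Tendsto (fun ε : ℝ => |loc2 2 e q2 (tadpoleMass 2 ε μ0)|) (𝓝[>] 0) atTop ∧
      Tendsto (fun ε : ℝ => loc3 2 e q2 ε (tadpoleMass 2 ε μ0)) (𝓝[>] 0) (𝓝 0)) := by
  have ha : -4 * ((N : ℝ) + 2) * lam ≠ 0 := mul_ne_zero (by positivity) hlam
  have hb : ∀ d : ℕ, 0 < d → e ^ 2 * (d : ℝ) * q2 ≠ 0 := fun d hd =>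
    mul_ne_zero (mul_ne_zero (pow_ne_zero 2 he) (by exact_mod_cast hd.ne')) hq
  refine ⟨⟨tendsto_abs_const_mul_atTop ha (tendsto_tadpoleMass_atTop_three hm), ?_, ?_⟩,
    ⟨tendsto_abs_const_mul_atTop ha (tendsto_tadpoleMass_atTop_two hm), ?_, ?_⟩⟩
  · simp only [abs_loc2_eq]
    exact tendsto_abs_const_mul_atTop (hb 3 (by norm_num)) (tendsto_tadpoleMass_atTop_three hμ)
  · have h := ((tendsto_eps_sq_mul_tadpoleMass_sq_three hμ).const_mul
      ((2 * 3 : ℝ) / (Nat.factorial 4 : ℕ) * (3 : ℕ) * e ^ 4)).mul_const (q2 ^ 2)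
    refine h.congr' (Eventually.of_forall fun ε => ?_)
    simp only [loc3]
    ring
  · simp only [abs_loc2_eq]
    exact tendsto_abs_const_mul_atTop (hb 2 (by norm_num)) (tendsto_tadpoleMass_atTop_two hμ)
  · have h := ((tendsto_eps_sq_mul_tadpoleMass_sq_two hμ).const_mul
      ((2 * 3 : ℝ) / (Nat.factorial 4 : ℕ) * (2 : ℕ) * e ^ 4)).mul_const (q2 ^ 2)
    rw [mul_zero, zero_mul] at h
    refine h.congr' (Eventually.of_forall fun ε => ?_)
    simp only [loc3]
    ring

end LocalTerms

end Literature.MathematicalPhysics.QuantumFieldTheory.Balaban1983to89.B3Eq122LocalDivergence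

end
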